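import Summits.ResolutionOfSingularities.ResolutionOfSingularities.Theorems.FrobeniusLadderFInjectiveMacaulayficationE8WeightedData
import Summits.ResolutionOfSingularities.ResolutionOfSingularities.Theorems.FrobeniusLadderFInjectiveMacaulayficationBP237WeightedFiModel
import Summits.ResolutionOfSingularities.ResolutionOfSingularities.Theorems.FrobeniusLadderFInjectiveMacaulayficationGradedConeFiModel
import Mathlib.RingTheory.MvPolynomial.WeightedHomogeneous
import Mathlib.Algebra.MvPolynomial.PDeriv
import Mathlib.Algebra.CharP.Lemmas
import Mathlib.Tactic.LinearCombination
import HarnessLib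

/-!
# BP(2,3,7) at the WILD primes `p = 2, 3, 7`: the data the graded engine consumes, and the model modulo G5
# (crux `FInjectiveMacaulayfication`, line `graded-engine` §16, calibration G6b)

Support file for crux stmt-ResolutionOfSingularities-15315 (`FrobeniusLadder.FInjectiveMacaulayfication`), chain w45a,
seat res-L1-w45a-stub-3. [OURS · L1 W4.5a, CRUX-PLAN v3 §C, calibration G6b] — replaces nothing of the manuscript; NOT a
statement of the manuscript; AI-written, weaker than expert review.

The Brieskorn–Pham surface point `f = X₂² + X₀³ + X₁⁷` (`X₀ = x`, `X₁ = y`, `X₂ = z`) is F-injectively Macaulayfied by ONE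
weighted blow-up (weights `w = (14, 6, 21)`, `N = 84`, cover exponents `c = (6, 14, 4)`, `D = 42`) at every TAME prime
`p ∉ {2,3,7}` (`BP237WeightedFiModel.bp237WeightedFiModel`, p466527, §15 μ-cover engine). At the WILD primes `p ∈ {2,3,7}` the
μ-cover charts are non-normal (tri-2 F10: `z′² + (1+y′)⁷` is a cusp `× 𝔸¹` at `p = 7`) and §15 is silent; the §16 GRADED ENGINE
G5 `stub_gradedConeFiModel` (registered, proved in the skeleton modulo G4 `stub_gradedChartClause`) needs no cover hypothesis,
only the four specimen inputs below — provided here for EVERY characteristic at once: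

* `bp237_isWeightedHomogeneous` — `f` is `(14,6,21)`-weighted-homogeneous of weight `42`;
* `bp237OffCentreRegular` — `z² + x³ + y⁷ = 0` has an ISOLATED singular point over EVERY field: in a field at most one of
  `2, 3, 7` vanishes (`3 − 2 = 1`, `7 − 3·2 = 1`, `7 − 2·3 = 1`), so among any two coordinates missing a prime `P ∌ 𝔪` one has a
  usable partial `3X₀²`, `7X₁⁶`, `2X₂` (Jacobian criterion `HypersurfaceRegular.stub_hypersurfaceRegularOfPderiv`), while two
  coordinates inside `P` force the third inside through `f ∈ P`;
* `bp237_offOrigin_clause` — the engines' off-origin clause hypothesis `hoff` at EVERY prime `p`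
  (`E8WeightedData.offOrigin_clause_of_regular`), with the named instances `bp237_offOrigin_clause_char2/3/7` of the seat table;
* `bp237_X_ne_zero` — no variable vanishes modulo `f` (`BP237WeightedFiModel.prime_bp237`).

Target modulo G5: `bp237GradedFiModel_of_gradedEngine` — the registered statement of G5 `stub_gradedConeFiModel` (verbatim, as a
hypothesis) implies that for EVERY prime `p` (in particular `p = 2, 3, 7`) the weighted blow-up `affineBlowup I₈₄` of
`Spec k[X]/(f)` is proper, birational, with Cohen–Macaulay F-injective domain stalks (saturation `BP237VeroneseSplitting`, p465729).
When G5 lands, `bp237GradedFiModel` (all `p`) is this theorem applied to it.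

All proofs are glue on Mathlib and landed files; no definitions, no named facts. References: [Matsumura1987] H. Matsumura,
*Commutative Ring Theory*, Thm. 30.4 (through the imported Jacobian discharger). [folklore]
-/

-- single-problem summit: the doubled namespace component is forced
set_option linter.dupNamespace false

noncomputable section

open CategoryTheory AlgebraicGeometry

namespace Summit.ResolutionOfSingularities.ResolutionOfSingularities.Theorems.FInjectiveMacaulayfication.BP237GradedData

open MvPolynomial
open Summit.ResolutionOfSingularities.ResolutionOfSingularities.Theorems.FInjectiveMacaulayfication

/-! ## Weighted homogeneity -/

/-- **`z² + x³ + y⁷` is weighted-homogeneous of weight `42` for the weights `(14,6,21)`** (`X₂²`, `X₀³`, `X₁⁷` all have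
weight `42`). [folklore] -/
theorem bp237_isWeightedHomogeneous (k : Type) [Field k] :
    MvPolynomial.IsWeightedHomogeneous (![14, 6, 21] : Fin 3 → ℕ)
      (X 2 ^ 2 + X 0 ^ 3 + X 1 ^ 7 : MvPolynomial (Fin 3) k) 42 := by
  refine ((?_ : IsWeightedHomogeneous _ _ 42).add ?_).add ?_
  · simpa using (isWeightedHomogeneous_X k (![14, 6, 21] : Fin 3 → ℕ) 2).pow 2
  · simpa using (isWeightedHomogeneous_X k (![14, 6, 21] : Fin 3 → ℕ) 0).pow 3
  · simpa using (isWeightedHomogeneous_X k (![14, 6, 21] : Fin 3 → ℕ) 1).pow 7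

/-! ## In a field at most one of `2, 3, 7` vanishes -/

/-- `2 ≠ 0 ∨ 3 ≠ 0` in a field (`3 − 2 = 1`). [folklore] -/
theorem two_ne_zero_or_three_ne_zero (k : Type*) [Field k] : (2 : k) ≠ 0 ∨ (3 : k) ≠ 0 := by
  rcases eq_or_ne (2 : k) 0 with h2 | h2
  · exact Or.inr fun h3 => one_ne_zero (by linear_combination h3 - h2 : (1 : k) = 0)
  · exact Or.inl h2

/-- `2 ≠ 0 ∨ 7 ≠ 0` in a field (`7 − 3·2 = 1`). [folklore] -/
theorem two_ne_zero_or_seven_ne_zero (k : Type*) [Field k] : (2 : k) ≠ 0 ∨ (7 : k) ≠ 0 := by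
  rcases eq_or_ne (2 : k) 0 with h2 | h2
  · exact Or.inr fun h7 => one_ne_zero (by linear_combination h7 - 3 * h2 : (1 : k) = 0)
  · exact Or.inl h2

/-- `3 ≠ 0 ∨ 7 ≠ 0` in a field (`7 − 2·3 = 1`). [folklore] -/
theorem three_ne_zero_or_seven_ne_zero (k : Type*) [Field k] : (3 : k) ≠ 0 ∨ (7 : k) ≠ 0 := by
  rcases eq_or_ne (3 : k) 0 with h3 | h3
  · exact Or.inr fun h7 => one_ne_zero (by linear_combination h7 - 2 * h3 : (1 : k) = 0)
  · exact Or.inl h3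

/-! ## Regularity off the origin, in every characteristic -/

/-- **`z² + x³ + y⁷ = 0` has an isolated singular point over every field**: for `f = X₂² + X₀³ + X₁⁷` and a prime `P` of
`R = k[X]/(f)` not containing `𝔪 = (x̄₀, x̄₁, x̄₂)`, `R_P` is regular. Two coordinates in `P₀ = P ∩ k[X]` force the third
(`X₂² = f − X₀³ − X₁⁷` etc.), so at least two coordinates miss `P₀`; since at most one of `2, 3, 7` vanishes in `k`, one of
the corresponding partials `3X₀², 7X₁⁶, 2X₂` misses `P₀` and the Jacobian criterion applies. [cite: Matsumura1987, Thm. 30.4 (ii)] -/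
theorem bp237OffCentreRegular : ∀ (k : Type) [Field k] (f : MvPolynomial (Fin 3) k),
    f = MvPolynomial.X 2 ^ 2 + MvPolynomial.X 0 ^ 3 + MvPolynomial.X 1 ^ 7 →
    ∀ (P : Ideal (MvPolynomial (Fin 3) k ⧸ Ideal.span {f})) [P.IsPrime],
      ¬ Ideal.span (Set.range fun j : Fin 3 => Ideal.Quotient.mk (Ideal.span {f}) (MvPolynomial.X j)) ≤ P →
      IsRegularLocalRing (Localization.AtPrime P) := by
  intro k _ f hf P _ hP
  haveI hprime : (P.comap (Ideal.Quotient.mk (Ideal.span {f}))).IsPrime := Ideal.comap_isPrime _ _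
  have hfP : f ∈ P.comap (Ideal.Quotient.mk (Ideal.span {f})) := by
    rw [Ideal.mem_comap, Ideal.Quotient.eq_zero_iff_mem.mpr (Ideal.mem_span_singleton_self f)]
    exact P.zero_mem
  -- two coordinates in `P₀` force the third, and all three contradict `¬ 𝔪 ≤ P`
  have hall : (X 0 : MvPolynomial (Fin 3) k) ∈ P.comap (Ideal.Quotient.mk (Ideal.span {f})) →
      (X 1 : MvPolynomial (Fin 3) k) ∈ P.comap (Ideal.Quotient.mk (Ideal.span {f})) →
      (X 2 : MvPolynomial (Fin 3) k) ∈ P.comap (Ideal.Quotient.mk (Ideal.span {f})) → False := by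
    intro h0 h1 h2
    refine hP ?_
    rw [Ideal.span_le, Set.range_subset_iff]
    intro j
    fin_cases j
    exacts [h0, h1, h2]
  have c2 : (X 0 : MvPolynomial (Fin 3) k) ∈ P.comap (Ideal.Quotient.mk (Ideal.span {f})) →
      (X 1 : MvPolynomial (Fin 3) k) ∈ P.comap (Ideal.Quotient.mk (Ideal.span {f})) →
      (X 2 : MvPolynomial (Fin 3) k) ∈ P.comap (Ideal.Quotient.mk (Ideal.span {f})) := by
    intro h0 h1
    refine hprime.mem_of_pow_mem 2 ?_
    have e : (X 2 ^ 2 : MvPolynomial (Fin 3) k) = f - X 0 ^ 3 - X 1 ^ 7 := by rw [hf]; ring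
    rw [e]
    exact Ideal.sub_mem _ (Ideal.sub_mem _ hfP (Ideal.pow_mem_of_mem _ h0 3 (by norm_num)))
      (Ideal.pow_mem_of_mem _ h1 7 (by norm_num))
  have c1 : (X 0 : MvPolynomial (Fin 3) k) ∈ P.comap (Ideal.Quotient.mk (Ideal.span {f})) →
      (X 2 : MvPolynomial (Fin 3) k) ∈ P.comap (Ideal.Quotient.mk (Ideal.span {f})) →
      (X 1 : MvPolynomial (Fin 3) k) ∈ P.comap (Ideal.Quotient.mk (Ideal.span {f})) := by
    intro h0 h2
    refine hprime.mem_of_pow_mem 7 ?_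
    have e : (X 1 ^ 7 : MvPolynomial (Fin 3) k) = f - X 2 ^ 2 - X 0 ^ 3 := by rw [hf]; ring
    rw [e]
    exact Ideal.sub_mem _ (Ideal.sub_mem _ hfP (Ideal.pow_mem_of_mem _ h2 2 (by norm_num)))
      (Ideal.pow_mem_of_mem _ h0 3 (by norm_num))
  have c0 : (X 1 : MvPolynomial (Fin 3) k) ∈ P.comap (Ideal.Quotient.mk (Ideal.span {f})) →
      (X 2 : MvPolynomial (Fin 3) k) ∈ P.comap (Ideal.Quotient.mk (Ideal.span {f})) →
      (X 0 : MvPolynomial (Fin 3) k) ∈ P.comap (Ideal.Quotient.mk (Ideal.span {f})) := by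
    intro h1 h2
    refine hprime.mem_of_pow_mem 3 ?_
    have e : (X 0 ^ 3 : MvPolynomial (Fin 3) k) = f - X 2 ^ 2 - X 1 ^ 7 := by rw [hf]; ring
    rw [e]
    exact Ideal.sub_mem _ (Ideal.sub_mem _ hfP (Ideal.pow_mem_of_mem _ h2 2 (by norm_num)))
      (Ideal.pow_mem_of_mem _ h1 7 (by norm_num))
  -- the three Jacobian dischargers
  have j0 : (3 : k) ≠ 0 → (X 0 : MvPolynomial (Fin 3) k) ∉ P.comap (Ideal.Quotient.mk (Ideal.span {f})) →
      IsRegularLocalRing (Localization.AtPrime P) := by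
    intro h3 h0
    refine HypersurfaceRegular.stub_hypersurfaceRegularOfPderiv k 3 f 0 P (fun hd => h0 ?_)
    have e : pderiv 0 f = C 3 * X 0 ^ 2 := by rw [hf, BP237WeightedFiModel.pderiv_zero_f, map_ofNat]
    rw [e] at hd
    exact hprime.mem_of_pow_mem 2 (E8OffCentreRegular.mem_of_C_mul_mem _ h3 hd)
  have j1 : (7 : k) ≠ 0 → (X 1 : MvPolynomial (Fin 3) k) ∉ P.comap (Ideal.Quotient.mk (Ideal.span {f})) →
      IsRegularLocalRing (Localization.AtPrime P) := by
    intro h7 h1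
    refine HypersurfaceRegular.stub_hypersurfaceRegularOfPderiv k 3 f 1 P (fun hd => h1 ?_)
    have e : pderiv 1 f = C 7 * X 1 ^ 6 := by rw [hf, BP237WeightedFiModel.pderiv_one_f, map_ofNat]
    rw [e] at hd
    exact hprime.mem_of_pow_mem 6 (E8OffCentreRegular.mem_of_C_mul_mem _ h7 hd)
  have j2 : (2 : k) ≠ 0 → (X 2 : MvPolynomial (Fin 3) k) ∉ P.comap (Ideal.Quotient.mk (Ideal.span {f})) →
      IsRegularLocalRing (Localization.AtPrime P) := by
    intro h2 hX2
    refine HypersurfaceRegular.stub_hypersurfaceRegularOfPderiv k 3 f 2 P (fun hd => hX2 ?_)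
    have e : pderiv 2 f = C 2 * X 2 := by rw [hf, BP237WeightedFiModel.pderiv_two_f, map_ofNat]
    rw [e] at hd
    exact E8OffCentreRegular.mem_of_C_mul_mem _ h2 hd
  -- case analysis on which coordinates lie in `P₀`
  by_cases h0 : (X 0 : MvPolynomial (Fin 3) k) ∈ P.comap (Ideal.Quotient.mk (Ideal.span {f}))
  · by_cases h1 : (X 1 : MvPolynomial (Fin 3) k) ∈ P.comap (Ideal.Quotient.mk (Ideal.span {f}))
    · exact (hall h0 h1 (c2 h0 h1)).elim
    · by_cases h2 : (X 2 : MvPolynomial (Fin 3) k) ∈ P.comap (Ideal.Quotient.mk (Ideal.span {f}))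
      · exact (h1 (c1 h0 h2)).elim
      · -- `X₁, X₂ ∉ P₀`
        rcases two_ne_zero_or_seven_ne_zero k with h | h
        · exact j2 h h2
        · exact j1 h h1
  · by_cases h1 : (X 1 : MvPolynomial (Fin 3) k) ∈ P.comap (Ideal.Quotient.mk (Ideal.span {f}))
    · by_cases h2 : (X 2 : MvPolynomial (Fin 3) k) ∈ P.comap (Ideal.Quotient.mk (Ideal.span {f}))
      · exact (h0 (c0 h1 h2)).elim
      · -- `X₀, X₂ ∉ P₀`
        rcases two_ne_zero_or_three_ne_zero k with h | h
        · exact j2 h h2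
        · exact j0 h h0
    · -- `X₀, X₁ ∉ P₀`
      rcases three_ne_zero_or_seven_ne_zero k with h | h
      · exact j0 h h0
      · exact j1 h h1

/-! ## The off-origin clause, at every prime `p` -/

/-- **BP(2,3,7): the off-origin clause at EVERY prime `p`** (input `hoff` of the weighted / graded blow-up engines): at every
maximal ideal `Q` of `k[X]/(f)` missing some `x̄ⱼ` the local ring satisfies the Cohen–Macaulay + Frobenius-closed clause
(regular there: `bp237OffCentreRegular` + `E8WeightedData.offOrigin_clause_of_regular`). [folklore] -/
theorem bp237_offOrigin_clause (p : ℕ) [Fact p.Prime] (k : Type) [Field k] [CharP k p] (f : MvPolynomial (Fin 3) k)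
    (hf : f = MvPolynomial.X 2 ^ 2 + MvPolynomial.X 0 ^ 3 + MvPolynomial.X 1 ^ 7) :
    ∀ (Q : Ideal (MvPolynomial (Fin 3) k ⧸ Ideal.span {f})) [Q.IsMaximal],
      (∃ j : Fin 3, Ideal.Quotient.mk (Ideal.span {f}) (MvPolynomial.X j) ∉ Q) →
      ∀ d : ℕ, ringKrullDim (Localization.AtPrime Q) = d → ∀ s : Fin d → Localization.AtPrime Q,
        (Ideal.span (Set.range s)).radical.IsMaximal →
          RingTheory.Sequence.IsWeaklyRegular (Localization.AtPrime Q) (List.ofFn s) ∧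
          ∀ y : Localization.AtPrime Q, (∃ e : ℕ, y ^ p ^ e ∈ Ideal.span
            ((fun z : Localization.AtPrime Q => z ^ p ^ e) ''
              (Ideal.span (Set.range s) : Set (Localization.AtPrime Q)))) → y ∈ Ideal.span (Set.range s) :=
  E8WeightedData.offOrigin_clause_of_regular p k f (fun P _ hP => bp237OffCentreRegular k f hf P hP)

/-- **BP(2,3,7), characteristic `2`: the off-origin clause** (seat-table name; `bp237_offOrigin_clause` at `p = 2`). [folklore] -/
theorem bp237_offOrigin_clause_char2 (k : Type) [Field k] [CharP k 2] (f : MvPolynomial (Fin 3) k)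
    (hf : f = MvPolynomial.X 2 ^ 2 + MvPolynomial.X 0 ^ 3 + MvPolynomial.X 1 ^ 7) :
    ∀ (Q : Ideal (MvPolynomial (Fin 3) k ⧸ Ideal.span {f})) [Q.IsMaximal],
      (∃ j : Fin 3, Ideal.Quotient.mk (Ideal.span {f}) (MvPolynomial.X j) ∉ Q) →
      ∀ d : ℕ, ringKrullDim (Localization.AtPrime Q) = d → ∀ s : Fin d → Localization.AtPrime Q,
        (Ideal.span (Set.range s)).radical.IsMaximal →
          RingTheory.Sequence.IsWeaklyRegular (Localization.AtPrime Q) (List.ofFn s) ∧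
          ∀ y : Localization.AtPrime Q, (∃ e : ℕ, y ^ 2 ^ e ∈ Ideal.span
            ((fun z : Localization.AtPrime Q => z ^ 2 ^ e) ''
              (Ideal.span (Set.range s) : Set (Localization.AtPrime Q)))) → y ∈ Ideal.span (Set.range s) := by
  haveI : Fact (Nat.Prime 2) := ⟨Nat.prime_two⟩
  exact bp237_offOrigin_clause 2 k f hf

/-- **BP(2,3,7), characteristic `3`: the off-origin clause** (seat-table name; `bp237_offOrigin_clause` at `p = 3`). [folklore] -/
theorem bp237_offOrigin_clause_char3 (k : Type) [Field k] [CharP k 3] (f : MvPolynomial (Fin 3) k)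
    (hf : f = MvPolynomial.X 2 ^ 2 + MvPolynomial.X 0 ^ 3 + MvPolynomial.X 1 ^ 7) :
    ∀ (Q : Ideal (MvPolynomial (Fin 3) k ⧸ Ideal.span {f})) [Q.IsMaximal],
      (∃ j : Fin 3, Ideal.Quotient.mk (Ideal.span {f}) (MvPolynomial.X j) ∉ Q) →
      ∀ d : ℕ, ringKrullDim (Localization.AtPrime Q) = d → ∀ s : Fin d → Localization.AtPrime Q,
        (Ideal.span (Set.range s)).radical.IsMaximal →
          RingTheory.Sequence.IsWeaklyRegular (Localization.AtPrime Q) (List.ofFn s) ∧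
          ∀ y : Localization.AtPrime Q, (∃ e : ℕ, y ^ 3 ^ e ∈ Ideal.span
            ((fun z : Localization.AtPrime Q => z ^ 3 ^ e) ''
              (Ideal.span (Set.range s) : Set (Localization.AtPrime Q)))) → y ∈ Ideal.span (Set.range s) := by
  haveI : Fact (Nat.Prime 3) := ⟨Nat.prime_three⟩
  exact bp237_offOrigin_clause 3 k f hf

/-- **BP(2,3,7), characteristic `7`: the off-origin clause** (seat-table name; `bp237_offOrigin_clause` at `p = 7`). [folklore] -/
theorem bp237_offOrigin_clause_char7 (k : Type) [Field k] [CharP k 7] (f : MvPolynomial (Fin 3) k)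
    (hf : f = MvPolynomial.X 2 ^ 2 + MvPolynomial.X 0 ^ 3 + MvPolynomial.X 1 ^ 7) :
    ∀ (Q : Ideal (MvPolynomial (Fin 3) k ⧸ Ideal.span {f})) [Q.IsMaximal],
      (∃ j : Fin 3, Ideal.Quotient.mk (Ideal.span {f}) (MvPolynomial.X j) ∉ Q) →
      ∀ d : ℕ, ringKrullDim (Localization.AtPrime Q) = d → ∀ s : Fin d → Localization.AtPrime Q,
        (Ideal.span (Set.range s)).radical.IsMaximal →
          RingTheory.Sequence.IsWeaklyRegular (Localization.AtPrime Q) (List.ofFn s) ∧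
          ∀ y : Localization.AtPrime Q, (∃ e : ℕ, y ^ 7 ^ e ∈ Ideal.span
            ((fun z : Localization.AtPrime Q => z ^ 7 ^ e) ''
              (Ideal.span (Set.range s) : Set (Localization.AtPrime Q)))) → y ∈ Ideal.span (Set.range s) := by
  haveI : Fact (Nat.Prime 7) := ⟨by norm_num⟩
  exact bp237_offOrigin_clause 7 k f hf

/-! ## No variable vanishes modulo `f` -/

/-- No variable lies in `(z² + x³ + y⁷)` (`BP237WeightedFiModel.prime_bp237`, second conjunct). [folklore] -/
theorem bp237_X_ne_zero (k : Type) [Field k] (f : MvPolynomial (Fin 3) k)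
    (hf : f = MvPolynomial.X 2 ^ 2 + MvPolynomial.X 0 ^ 3 + MvPolynomial.X 1 ^ 7) (v : Fin 3) :
    Ideal.Quotient.mk (Ideal.span {f}) (MvPolynomial.X v) ≠ 0 := fun h =>
  (BP237WeightedFiModel.prime_bp237 k f hf).2 v (Ideal.mem_span_singleton.mp (Ideal.Quotient.eq_zero_iff_mem.mp h))

/-! ## G6b modulo G5: one `(14,6,21)`-weighted blow-up at every prime -/

/-- **G6b modulo G5 — ONE WEIGHTED BLOW-UP F-INJECTIVIZES THE BP(2,3,7) POINT AT EVERY PRIME, GIVEN THE GRADED ENGINE**: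
assuming the registered statement of G5 `stub_gradedConeFiModel` (hypothesis `hG5`, verbatim), for every prime `p` — in
particular the wild primes `p = 2, 3, 7` where the μ-cover engine §15 is silent — and every field `k` of characteristic `p`,
`Spec k[X₀,X₁,X₂]/(X₂² + X₀³ + X₁⁷)` has a proper birational model (the weighted blow-up of the origin, weights `(14,6,21)`,
`affineBlowup I₈₄`, `c = (6,14,4)`, `D = 42`) all of whose stalks are domains in which every system of parameters is weakly
regular and generates a Frobenius closed ideal. Inputs: saturation `BP237VeroneseSplitting.bp237VeroneseSplitting` (p465729),
homogeneity `bp237_isWeightedHomogeneous`, primality `BP237WeightedFiModel.prime_bp237`, `bp237_X_ne_zero`, and the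
off-origin clause `bp237_offOrigin_clause`. [folklore] -/
theorem bp237GradedFiModel_of_gradedEngine
    (hG5 : ∀ (p : ℕ) [Fact p.Prime] (k : Type) [Field k] [CharP k p] (n : ℕ) (w : Fin n → ℕ) (N D : ℕ)
      (c : Fin n → ℕ), 0 < N → (∀ v : Fin n, 0 < w v ∧ c v * w v = N) →
      (∀ (K : ℕ) (b : Fin n →₀ ℕ), K * N ≤ Finsupp.weight w b → (MvPolynomial.monomial b (1 : k) : MvPolynomial (Fin n) k) ∈
        (Ideal.span {m : MvPolynomial (Fin n) k | ∃ b : Fin n →₀ ℕ, N ≤ Finsupp.weight w b ∧ m = MvPolynomial.monomial b 1}) ^ K) →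
      ∀ (f : MvPolynomial (Fin n) k), MvPolynomial.IsWeightedHomogeneous w f D → (Ideal.span {f}).IsPrime →
      (∀ v : Fin n, Ideal.Quotient.mk (Ideal.span {f}) (MvPolynomial.X v) ≠ 0) →
      (∀ (Q : Ideal (MvPolynomial (Fin n) k ⧸ Ideal.span {f})) [Q.IsMaximal],
        (∃ j : Fin n, Ideal.Quotient.mk (Ideal.span {f}) (MvPolynomial.X j) ∉ Q) →
        ∀ d : ℕ, ringKrullDim (Localization.AtPrime Q) = d → ∀ s : Fin d → Localization.AtPrime Q,
          (Ideal.span (Set.range s)).radical.IsMaximal →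
            RingTheory.Sequence.IsWeaklyRegular (Localization.AtPrime Q) (List.ofFn s) ∧
            ∀ y : Localization.AtPrime Q, (∃ e : ℕ, y ^ p ^ e ∈ Ideal.span
              ((fun z : Localization.AtPrime Q => z ^ p ^ e) ''
                (Ideal.span (Set.range s) : Set (Localization.AtPrime Q)))) → y ∈ Ideal.span (Set.range s)) →
      ∃ (X' : Scheme.{0}) (π : X' ⟶ Spec (.of (MvPolynomial (Fin n) k ⧸ Ideal.span {f}))), IsProper π ∧
        Literature.AlgebraicGeometry.Resolution.IsBirational π ∧
        ∀ y : X', IsDomain (X'.presheaf.stalk y) ∧ ∀ d : ℕ, ringKrullDim (X'.presheaf.stalk y) = d →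
          ∀ s : Fin d → X'.presheaf.stalk y, (Ideal.span (Set.range s)).radical.IsMaximal →
            RingTheory.Sequence.IsWeaklyRegular (X'.presheaf.stalk y) (List.ofFn s) ∧
            ∀ z : X'.presheaf.stalk y, (∃ e : ℕ, z ^ p ^ e ∈
                Ideal.span ((fun w : X'.presheaf.stalk y => w ^ p ^ e) ''
                  (Ideal.span (Set.range s) : Set (X'.presheaf.stalk y)))) →
              z ∈ Ideal.span (Set.range s)) :
    ∀ (p : ℕ) [Fact p.Prime] (k : Type) [Field k] [CharP k p]
      (f : MvPolynomial (Fin 3) k), f = MvPolynomial.X 2 ^ 2 + MvPolynomial.X 0 ^ 3 + MvPolynomial.X 1 ^ 7 →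
      ∃ (X' : Scheme.{0}) (π : X' ⟶ Spec (.of (MvPolynomial (Fin 3) k ⧸ Ideal.span {f}))), IsProper π ∧
        Literature.AlgebraicGeometry.Resolution.IsBirational π ∧
        ∀ y : X', IsDomain (X'.presheaf.stalk y) ∧ ∀ d : ℕ, ringKrullDim (X'.presheaf.stalk y) = d →
          ∀ s : Fin d → X'.presheaf.stalk y, (Ideal.span (Set.range s)).radical.IsMaximal →
            RingTheory.Sequence.IsWeaklyRegular (X'.presheaf.stalk y) (List.ofFn s) ∧
            ∀ z : X'.presheaf.stalk y, (∃ e : ℕ, z ^ p ^ e ∈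
                Ideal.span ((fun w : X'.presheaf.stalk y => w ^ p ^ e) ''
                  (Ideal.span (Set.range s) : Set (X'.presheaf.stalk y)))) →
              z ∈ Ideal.span (Set.range s) := by
  intro p _ k _ _ f hf
  have hprime : (Ideal.span {f}).IsPrime :=
    (Ideal.span_singleton_prime (BP237WeightedFiModel.prime_bp237 k f hf).1.ne_zero).mpr
      (BP237WeightedFiModel.prime_bp237 k f hf).1
  refine hG5 p k 3 ![14, 6, 21] 84 42 ![6, 14, 4] (by norm_num) (by decide)
    (BP237VeroneseSplitting.bp237VeroneseSplitting k) f ?_ hprime (bp237_X_ne_zero k f hf)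
    (bp237_offOrigin_clause p k f hf)
  rw [hf]
  exact bp237_isWeightedHomogeneous k

/-- **G6b modulo G5 at the wild primes** (the seat-table form `p ∈ {2,3,7}`; a restriction of
`bp237GradedFiModel_of_gradedEngine`, which holds at every prime). [folklore] -/
theorem bp237GradedFiModel_wild_of_gradedEngine
    (hG5 : ∀ (p : ℕ) [Fact p.Prime] (k : Type) [Field k] [CharP k p] (n : ℕ) (w : Fin n → ℕ) (N D : ℕ)
      (c : Fin n → ℕ), 0 < N → (∀ v : Fin n, 0 < w v ∧ c v * w v = N) →
      (∀ (K : ℕ) (b : Fin n →₀ ℕ), K * N ≤ Finsupp.weight w b → (MvPolynomial.monomial b (1 : k) : MvPolynomial (Fin n) k) ∈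
        (Ideal.span {m : MvPolynomial (Fin n) k | ∃ b : Fin n →₀ ℕ, N ≤ Finsupp.weight w b ∧ m = MvPolynomial.monomial b 1}) ^ K) →
      ∀ (f : MvPolynomial (Fin n) k), MvPolynomial.IsWeightedHomogeneous w f D → (Ideal.span {f}).IsPrime →
      (∀ v : Fin n, Ideal.Quotient.mk (Ideal.span {f}) (MvPolynomial.X v) ≠ 0) →
      (∀ (Q : Ideal (MvPolynomial (Fin n) k ⧸ Ideal.span {f})) [Q.IsMaximal],
        (∃ j : Fin n, Ideal.Quotient.mk (Ideal.span {f}) (MvPolynomial.X j) ∉ Q) →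
        ∀ d : ℕ, ringKrullDim (Localization.AtPrime Q) = d → ∀ s : Fin d → Localization.AtPrime Q,
          (Ideal.span (Set.range s)).radical.IsMaximal →
            RingTheory.Sequence.IsWeaklyRegular (Localization.AtPrime Q) (List.ofFn s) ∧
            ∀ y : Localization.AtPrime Q, (∃ e : ℕ, y ^ p ^ e ∈ Ideal.span
              ((fun z : Localization.AtPrime Q => z ^ p ^ e) ''
                (Ideal.span (Set.range s) : Set (Localization.AtPrime Q)))) → y ∈ Ideal.span (Set.range s)) →
      ∃ (X' : Scheme.{0}) (π : X' ⟶ Spec (.of (MvPolynomial (Fin n) k ⧸ Ideal.span {f}))), IsProper π ∧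
        Literature.AlgebraicGeometry.Resolution.IsBirational π ∧
        ∀ y : X', IsDomain (X'.presheaf.stalk y) ∧ ∀ d : ℕ, ringKrullDim (X'.presheaf.stalk y) = d →
          ∀ s : Fin d → X'.presheaf.stalk y, (Ideal.span (Set.range s)).radical.IsMaximal →
            RingTheory.Sequence.IsWeaklyRegular (X'.presheaf.stalk y) (List.ofFn s) ∧
            ∀ z : X'.presheaf.stalk y, (∃ e : ℕ, z ^ p ^ e ∈
                Ideal.span ((fun w : X'.presheaf.stalk y => w ^ p ^ e) ''
                  (Ideal.span (Set.range s) : Set (X'.presheaf.stalk y)))) →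
              z ∈ Ideal.span (Set.range s)) :
    ∀ (p : ℕ) [Fact p.Prime], (p = 2 ∨ p = 3 ∨ p = 7) → ∀ (k : Type) [Field k] [CharP k p]
      (f : MvPolynomial (Fin 3) k), f = MvPolynomial.X 2 ^ 2 + MvPolynomial.X 0 ^ 3 + MvPolynomial.X 1 ^ 7 →
      ∃ (X' : Scheme.{0}) (π : X' ⟶ Spec (.of (MvPolynomial (Fin 3) k ⧸ Ideal.span {f}))), IsProper π ∧
        Literature.AlgebraicGeometry.Resolution.IsBirational π ∧
        ∀ y : X', IsDomain (X'.presheaf.stalk y) ∧ ∀ d : ℕ, ringKrullDim (X'.presheaf.stalk y) = d →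
          ∀ s : Fin d → X'.presheaf.stalk y, (Ideal.span (Set.range s)).radical.IsMaximal →
            RingTheory.Sequence.IsWeaklyRegular (X'.presheaf.stalk y) (List.ofFn s) ∧
            ∀ z : X'.presheaf.stalk y, (∃ e : ℕ, z ^ p ^ e ∈
                Ideal.span ((fun w : X'.presheaf.stalk y => w ^ p ^ e) ''
                  (Ideal.span (Set.range s) : Set (X'.presheaf.stalk y)))) →
              z ∈ Ideal.span (Set.range s) :=
  fun p _ _ k _ _ f hf => bp237GradedFiModel_of_gradedEngine hG5 p k f hf

/-- **BP(2,3,7) IN ONE WEIGHTED BLOW-UP AT EVERY PRIME — UNCONDITIONAL** (G6b; the graded engine G5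
`GradedConeFiModel.stub_gradedConeFiModel` has LANDED, p488729): for every prime `p` and field `k` of characteristic `p`,
`Spec k[X₀,X₁,X₂]/(X₂² + X₀³ + X₁⁷)` has a proper birational model — the `(14,6,21)`-weighted blow-up of the origin — all of whose
stalks are domains in which every system of parameters is weakly regular and generates a Frobenius closed ideal; in particular at the
WILD primes `p = 2, 3, 7`, where every tower of point blow-ups fails. [folklore] -/
theorem bp237GradedFiModel : ∀ (p : ℕ) [Fact p.Prime] (k : Type) [Field k] [CharP k p]
      (f : MvPolynomial (Fin 3) k), f = MvPolynomial.X 2 ^ 2 + MvPolynomial.X 0 ^ 3 + MvPolynomial.X 1 ^ 7 →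
      ∃ (X' : Scheme.{0}) (π : X' ⟶ Spec (.of (MvPolynomial (Fin 3) k ⧸ Ideal.span {f}))), IsProper π ∧
        Literature.AlgebraicGeometry.Resolution.IsBirational π ∧
        ∀ y : X', IsDomain (X'.presheaf.stalk y) ∧ ∀ d : ℕ, ringKrullDim (X'.presheaf.stalk y) = d →
          ∀ s : Fin d → X'.presheaf.stalk y, (Ideal.span (Set.range s)).radical.IsMaximal →
            RingTheory.Sequence.IsWeaklyRegular (X'.presheaf.stalk y) (List.ofFn s) ∧
            ∀ z : X'.presheaf.stalk y, (∃ e : ℕ, z ^ p ^ e ∈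
                Ideal.span ((fun w : X'.presheaf.stalk y => w ^ p ^ e) ''
                  (Ideal.span (Set.range s) : Set (X'.presheaf.stalk y)))) →
              z ∈ Ideal.span (Set.range s) :=
  bp237GradedFiModel_of_gradedEngine GradedConeFiModel.stub_gradedConeFiModel

end Summit.ResolutionOfSingularities.ResolutionOfSingularities.Theorems.FInjectiveMacaulayfication.BP237GradedData

end
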